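import Literature.NumberTheory.LFunctions.Zhang2022.Section10Lemma102Windows
import Literature.NumberTheory.LFunctions.Zhang2022.Section8XiZeroTailMeanLogFree
import Literature.NumberTheory.LFunctions.Zhang2022.AppendixALemma83RelHolds
import HarnessLib

/-!
# Zhang (2022) §10, Lemma 10.2 (10.11) p. 55: the `𝓛`-FREE crude bound for the `𝔳₂ⱼ`-sum `frakv2`
# on `dr < P^{0.504}` — the derivable window input of the evaluation of `Θ₁(𝐚₁₁,𝐚₁₃)` (Z22:§10.u036–u038)

Topic `Literature/NumberTheory/LFunctions/Zhang2022` (Landau–Siegel audit tree; verdict-neutral).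
Y. Zhang, *Discrete mean estimates and the Landau–Siegel zero*, arXiv:2211.02515v1 (2022)
[Zhang2022LandauSiegel], §10 Lemma 10.2 pp. 55–56 ((10.11): "`𝔳₂ⱼ(d,r) ≪ 𝓛⁻⁷`" on the three
`T`-windows) and p. 57 ("By Lemma 10.2 and the results in Section 8, the sum over `dr < P^{0.5}` is
equal to …") — **an unrefereed manuscript under adjudication; nothing here bears on its Theorems 1–2.**
ZHANG-L discharge lane (WP10, seat zl-w10-typer; an OPTIONAL sharper input for the window pieces of
the range edges `Eq1036a` / `Eq1037a` / `Eq1038a` of the leaf `Typed.Sec10B.Concl1113`, seats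
zl-w10-p3 / -p5; GAP row G-d60-1: the printed `O(𝓛⁻⁷)` has no derivation route and is NOT claimed).

The `n`-sum of `S_j(𝐚₁₁,𝐚₁₃)` is `nSum13 = frakv2` (`Skeleton.nSum13_eq_frakv2`). Outside the
evaluation ranges of (10.8)–(10.10) — i.e. when `dr` lies in one of the windows `(P^{a}/T, P^{a}]` — only
a WEAK bound is derivable (zl-w10-p6's `Lemma102.frakv2_low_le_of_lemma83Rel`, RT-01′ clause 4 of
record R-26, rate `C·𝓛(1 + 𝓛^{1.1})⁴(𝓛⁹)⁻¹·R(d,r)`): by the tent decomposition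
`𝔳₂ⱼ = (500/log P)(A(X₁) − 2A(X₂) + A(X₃))` (`Lemma102.frakv2_eq_logMeans`, `X_k = P^{a_k}/(dr)`) each
log-mean `A(X)` is `0` (`X < 1`), `≪ (1 + log T)⁴` (`1 ≤ X ≤ T`, by the `𝓛`-FREE tail mean
`XiZeroMajorant.xiZeroTailMean_logFree` of zl-w10-p2 — this is the only change w.r.t. zl-w10-p6's file,
which used `xiZeroTailMean` with its stray factor `𝓛`), or `≪ 𝓛²R(d,r)` (`T ≤ X ≤ P`, LEMMA A
`Lemma102.logMeanRel_of_lemma83Rel`), `R(d,r) = (∏_{q∣dr}(1−q⁻¹)⁻¹)²`. This file is the unshifted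
twin of zl-w10-p2's `Section10cFrakv2SWindows` (`frakv2S_le_ell4`) and proves, by the same argument:

* `frakv2_le_logFree_of_lemma83Rel` — under `Skeleton.Lemma83Rel c′`: for `D` large, (A),
  `j ∈ {1,2,3}`, `d, r ≥ 1`, `dr < P^{0.504}`: `‖𝔳₂ⱼ(d,r)‖ ≤ C·(1 + 𝓛^{1.1})⁴(𝓛⁹)⁻¹·R(d,r)`;
* `frakv2_le_ell4_of_lemma83Rel` — the integer-exponent corollary `‖𝔳₂ⱼ(d,r)‖ ≤ C·(𝓛⁴)⁻¹·R(d,r)`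
  (`(1 + 𝓛^{1.1})⁴ ≤ 16𝓛⁵`), the form the range assemblies consume;
* `frakv2_le_logFree`, `frakv2_le_ell4` — the same UNCONDITIONALLY (`Skeleton.lemma83Rel_holds`, WP09);
* `frakv2_windows_le_ell4` — the unconditional `(𝓛⁴)⁻¹` bound restricted to the three edge windows,
  hypothesis shaped as clause 4 of `Skeleton.Lemma102 c′` (the `hW`-slot of the `Eq103xa` edges).

Budget note for the consumers: against the `m`-sum main value `≍ |L′(1,χ)|/log P₁ ≲ 𝓛⁻⁷` and a
`dr`-window of log-length `𝓛^{1.1}`, the window contribution is `≲ 𝓛^{1.1−7−4} = 𝓛^{−9.9} = o(α)`,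
`α = π𝓛⁻⁹` (margin `𝓛^{0.9}`, vs `𝓛^{0.5}` with the R-26 rate). Theorem-only; no definitions, no named
facts; the RT-01′ binder `Skeleton.Lemma102RelW` and its clause-4 text are untouched.

## References

* Y. Zhang, arXiv:2211.02515v1 (2022), §10 Lemma 10.2 (10.11) pp. 55–56, p. 57; §7 p. 13 (`ξ₀ⱼ`).
  [cite: Zhang2022LandauSiegel, §10 Lemma 10.2 (10.11) p. 55]
-/

noncomputable section

open Complex Real Finset

namespace Literature.NumberTheory.LFunctions.Zhang2022.Lemma102

open Skeleton

/-- A threshold `D₁` beyond which `log D ≥ M`. [folklore] -/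
private theorem exists_nat_le_log₄ (M : ℝ) : ∃ D₀ : ℕ, ∀ D : ℕ, D₀ ≤ D → M ≤ Real.log D := by
  refine ⟨⌈Real.exp M⌉₊ + 1, fun D hD => ?_⟩
  have h1 : Real.exp M ≤ D := by
    have : (⌈Real.exp M⌉₊ : ℝ) + 1 ≤ D := by exact_mod_cast hD
    linarith [Nat.le_ceil (Real.exp M)]
  have hD0 : (0 : ℝ) < D := lt_of_lt_of_le (Real.exp_pos M) h1
  rw [Real.le_log_iff_exp_le hD0]
  exact h1

/-- `𝓛 ≥ 5 ⇒ D ≥ 3`. [folklore] -/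
private theorem three_le_of_five_le_ell₄ {D : ℕ} (hL5 : 5 ≤ ell D) : 3 ≤ D := by
  by_contra h
  have hD2 : D ≤ 2 := by omega
  have : Real.log (D : ℝ) ≤ Real.log 2 := by
    rcases Nat.eq_zero_or_pos D with h0 | h0
    · rw [h0]; simp; exact Real.log_nonneg one_le_two
    · exact Real.log_le_log (by exact_mod_cast h0) (by exact_mod_cast hD2)
  have h2 : Real.log 2 < 1 := by
    have := Real.log_two_lt_d9; linarith
  rw [ell] at hL5
  linarith

set_option maxHeartbeats 800000 in
-- one long bookkeeping proof at a fixed modulus (three cases per log-mean, explicit constants); the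
-- same budget as zl-w10-p6's `frakv2_low_le_of_lemma83Rel`, of which this is the `𝓛`-free copy
/-- **The `𝓛`-free weak bound for the `𝔳₂ⱼ`-sum on `1 ≤ dr < P^{0.504}`** (a superset of the three
edge windows of (10.11)): under `Skeleton.Lemma83Rel c′` there is `C` with, for `D` large, (A),
`1 ≤ j ≤ 3`, `d, r ≥ 1`, `dr < P^{0.504}`: `‖𝔳₂ⱼ(d,r)‖ ≤ C·(1 + 𝓛^{1.1})⁴(𝓛⁹)⁻¹·(∏_{q∣dr}(1−q⁻¹)⁻¹)²`.
Each of the three log-means of the tent decomposition (`frakv2_eq_logMeans`, arguments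
`X_k = P^{a_k}/(dr)`) is `0` (`X < 1`), `≤ log X·Σ_{n<X}|ξ₀ⱼ|/n ≪ (1 + log T)⁴` (`1 ≤ X ≤ T`, `𝓛`-free
tail mean) or `≪ 𝓛²R` (`T ≤ X ≤ P`, LEMMA A). The printed `O(𝓛⁻⁷)` is not claimed (row G-d60-1).
[cite: Zhang2022LandauSiegel, §10 Lemma 10.2 (10.11) p. 55] -/
theorem frakv2_le_logFree_of_lemma83Rel {c' : ℝ} (h83 : Lemma83Rel c') :
    ∃ C : ℝ, ForAllLarge fun D _ χ => AssumptionA D χ → ∀ j ∈ ({1, 2, 3} : Finset ℕ), ∀ d r : ℕ,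
      1 ≤ d → 1 ≤ r → ((d * r : ℕ) : ℝ) < bigP D ^ (0.504 : ℝ) →
        ‖frakv2 c' χ j d r‖ ≤
          C * ((1 + ell D ^ (1.1 : ℝ)) ^ 4 * (ell D ^ 9)⁻¹) *
            (∏ q ∈ (d * r).primeFactors, (1 - (q : ℝ)⁻¹)⁻¹) ^ 2 := by
  obtain ⟨CA, DA, hA⟩ := logMeanRel_of_lemma83Rel h83
  obtain ⟨Cξ, Dξ, hξ⟩ := XiZeroMajorant.xiZeroTailMean_logFree c'
  obtain ⟨D₅, hD₅⟩ := exists_nat_le_log₄ 5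
  -- constants
  set b₀ : ℝ := 3 * π * (1 + 5 * |c'| * π) with hb₀
  have hb₀0 : 0 ≤ b₀ := by positivity
  set cb : ℝ := 1 + 2 * b₀ + b₀ ^ 2 / 2 with hcb
  have hcb1 : 1 ≤ cb := by rw [hcb]; nlinarith
  set K₁ : ℝ := 4 * Real.exp (9 / 2) * cb + |CA| + |Cξ| with hK₁
  have hK₁0 : 0 ≤ K₁ := by positivity
  refine ⟨2000 * K₁, max (max DA Dξ) D₅, fun D _ χ hD hq hp hAA j hj d r hd hr hdr => ?_⟩
  have hDA : DA ≤ D := le_trans (le_trans (le_max_left _ _) (le_max_left _ _)) hD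
  have hDξ : Dξ ≤ D := le_trans (le_trans (le_max_right _ _) (le_max_left _ _)) hD
  have hL5 : 5 ≤ ell D := by rw [ell]; exact hD₅ D (le_trans (le_max_right _ _) hD)
  set 𝓛 : ℝ := ell D with h𝓛def
  have h𝓛3 : 3 ≤ Real.log D := by rw [← ell, ← h𝓛def]; linarith
  have hlog2 : 2 ≤ Real.log D := by linarith
  have h𝓛1 : 1 ≤ 𝓛 := by linarith
  have h𝓛0 : 0 < 𝓛 := by linarith
  have hD3 : 3 ≤ D := three_le_of_five_le_ell₄ hL5
  -- parameters
  have hP1 : 1 < bigP D := by rw [bigP]; exact Real.one_lt_exp_iff.2 (by positivity)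
  have hP0 : 0 < bigP D := by linarith
  have hlogP : Real.log (bigP D) = 𝓛 ^ 9 := by rw [bigP, Real.log_exp]
  have hT1 : 1 ≤ bigT D := by
    rw [bigT]; exact Real.one_le_exp (Real.rpow_nonneg (by linarith) _)
  have hT0 : 0 < bigT D := by linarith
  have hlogT : Real.log (bigT D) = 𝓛 ^ (1.1 : ℝ) := by rw [bigT, Real.log_exp]
  have hlogT0 : 0 ≤ Real.log (bigT D) := Real.log_nonneg hT1
  -- `y = dr ≥ 1`, `dr < P₁ = P^{0.504} < PT⁻²`
  have hy1 : (1 : ℝ) ≤ ((d * r : ℕ) : ℝ) := by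
    have : 1 ≤ d * r := Nat.one_le_iff_ne_zero.mpr (Nat.mul_ne_zero (by omega) (by omega))
    exact_mod_cast this
  have hy0 : (0 : ℝ) < ((d * r : ℕ) : ℝ) := by linarith
  have hdrP1 : ((d * r : ℕ) : ℝ) < Skeleton.P1 D := hdr
  have hdrPT : ((d * r : ℕ) : ℝ) < bigP D / bigT D ^ 2 :=
    lt_trans hdrP1 (P1_lt_P_div_T_sq (D := D) hlog2)
  -- the relative factor
  set R : ℝ := (∏ q ∈ (d * r).primeFactors, (1 - (q : ℝ)⁻¹)⁻¹) ^ 2 with hRdef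
  have hR1 : 1 ≤ R := by
    rw [hRdef]
    exact one_le_pow₀
      (Literature.NumberTheory.Sieve.GreenTao2008.GYCorr.one_le_prod_one_sub_inv_inv (d * r))
  have hR0 : 0 ≤ R := by linarith
  -- `|L′(1,χ)| ≤ 4e^{9/2}𝓛²`, `|Π| ≤ R`, `‖β_i‖𝓛⁹ ≤ b₀`
  have hℓ : ‖deriv χ.LFunction 1‖ ≤ 4 * Real.exp (9 / 2) * 𝓛 ^ 2 := by
    have h := Lemma31.norm_deriv_LFunction_le_near_one χ h𝓛3 hp (w := 1)
      (by rw [sub_self, norm_zero]; positivity)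
    rw [← ell, ← h𝓛def] at h
    refine h.trans ?_
    have h2 : (1 + 𝓛) * 𝓛 ≤ 2 * 𝓛 ^ 2 := by nlinarith
    have he := Real.exp_pos (9 / 2)
    calc 2 * Real.exp (9 / 2) * (1 + 𝓛) * 𝓛 = 2 * Real.exp (9 / 2) * ((1 + 𝓛) * 𝓛) := by ring
      _ ≤ 2 * Real.exp (9 / 2) * (2 * 𝓛 ^ 2) := by gcongr
      _ = 4 * Real.exp (9 / 2) * 𝓛 ^ 2 := by ring
  have hPi : ‖PiW χ d r‖ ≤ R := Lemma84.norm_PiW_le_prodInv χ (by omega) (by omega)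
  have hβ9 : ∀ i : ℕ, ‖betaJ c' D i‖ * 𝓛 ^ 9 ≤ b₀ := fun i =>
    Typed.Sec10A.norm_betaJ_mul_ell9_le c' hD3 i
  -- the window growth factor `W = (1 + 𝓛^{1.1})⁴` and the uniform bound `B` for one log-mean
  have hτ0 : 0 ≤ 𝓛 ^ (1.1 : ℝ) := Real.rpow_nonneg h𝓛0.le _
  have hτ1 : 𝓛 ≤ 𝓛 ^ (1.1 : ℝ) := by
    calc 𝓛 = 𝓛 ^ (1 : ℝ) := (Real.rpow_one _).symm
      _ ≤ 𝓛 ^ (1.1 : ℝ) := Real.rpow_le_rpow_of_exponent_le h𝓛1 (by norm_num)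
  have hu1 : 1 ≤ 1 + 𝓛 ^ (1.1 : ℝ) := by linarith
  obtain ⟨W, hWdef⟩ : ∃ W : ℝ, W = (1 + 𝓛 ^ (1.1 : ℝ)) ^ 4 := ⟨_, rfl⟩
  have hW2 : 1 ≤ W := by rw [hWdef]; exact one_le_pow₀ hu1
  have hW0 : 0 ≤ W := by linarith
  have hW1 : 𝓛 ^ 2 ≤ W := by
    rw [hWdef]
    have h2 : 𝓛 ^ 2 ≤ (1 + 𝓛 ^ (1.1 : ℝ)) ^ 2 :=
      pow_le_pow_left₀ h𝓛0.le (by linarith) 2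
    exact h2.trans (pow_le_pow_right₀ hu1 (by norm_num))
  have hW4 : (1 + 𝓛 ^ (1.1 : ℝ)) * (1 + 𝓛 ^ (1.1 : ℝ)) ^ 3 = W := by rw [hWdef]; ring
  obtain ⟨B, hBdef⟩ : ∃ B : ℝ, B = (‖deriv χ.LFunction 1‖ * cb + |CA| * (𝓛 ^ 6)⁻¹) * R +
    |Cξ| * W := ⟨_, rfl⟩
  have hBmain0 : 0 ≤ (‖deriv χ.LFunction 1‖ * cb + |CA| * (𝓛 ^ 6)⁻¹) * R := by positivity
  have hBtail0 : 0 ≤ |Cξ| * W := by positivity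
  have hB0 : 0 ≤ B := by rw [hBdef]; positivity
  have hpiece : ∀ a : ℝ, a ≤ 0.504 →
      ‖∑ n ∈ Finset.Ioc 0 ⌊bigP D ^ a / ((d * r : ℕ) : ℝ)⌋₊,
          χ (n : ZMod D) * xiZero c' D j n d r / (n : ℂ) *
            (Real.log (bigP D ^ a / ((d * r : ℕ) : ℝ) / n) : ℂ)‖ ≤ B := by
    intro a ha
    set X : ℝ := bigP D ^ a / ((d * r : ℕ) : ℝ) with hXdef
    have hXP : X ≤ bigP D := by
      calc X ≤ bigP D ^ a := div_le_self (by positivity) hy1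
        _ ≤ bigP D ^ (1 : ℝ) := Real.rpow_le_rpow_of_exponent_le hP1.le (by linarith)
        _ = bigP D := Real.rpow_one _
    rcases lt_or_ge X 1 with hX1 | hX1
    · -- `X < 1`: the log-mean vanishes
      rw [logMean_eq_zero_of_lt_one (fun n => χ (n : ZMod D) * xiZero c' D j n d r / (n : ℂ)) hX1,
        norm_zero]
      exact hB0
    have hX0 : 0 < X := by linarith
    have hlogX0 : 0 ≤ Real.log X := Real.log_nonneg hX1
    rcases le_or_gt X (bigT D) with hXT | hXT
    · -- `1 ≤ X ≤ T`: the (`𝓛`-free) tail mean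
      have htail := hξ D χ hDξ hq hp j hj d r hd hr hdrP1 X hX1 hXT
      have hlogXT : Real.log X ≤ 𝓛 ^ (1.1 : ℝ) := by
        rw [← hlogT]; exact Real.log_le_log hX0 hXT
      have hsum0 : 0 ≤ ∑ n ∈ Finset.Ico 1 ⌈X⌉₊, ‖xiZero c' D j n d r‖ / n :=
        Finset.sum_nonneg fun n _ => by positivity
      calc _ ≤ Real.log X * ∑ n ∈ Finset.Ico 1 ⌈X⌉₊, ‖xiZero c' D j n d r‖ / n :=
            norm_logMean_le_log_mul_tail c' χ j d r hX1
        _ ≤ Real.log X * (Cξ * (1 + Real.log X) ^ 3) :=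
            mul_le_mul_of_nonneg_left htail hlogX0
        _ ≤ Real.log X * (|Cξ| * (1 + Real.log X) ^ 3) := by
            gcongr; exact le_abs_self _
        _ ≤ (1 + 𝓛 ^ (1.1 : ℝ)) * (|Cξ| * (1 + 𝓛 ^ (1.1 : ℝ)) ^ 3) := by
            apply mul_le_mul (by linarith) _ (by positivity) (by positivity)
            gcongr
        _ = |Cξ| * ((1 + 𝓛 ^ (1.1 : ℝ)) * (1 + 𝓛 ^ (1.1 : ℝ)) ^ 3) := by ring
        _ = |Cξ| * W := by rw [hW4]
        _ ≤ B := by rw [hBdef]; linarith [hBmain0]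
    · -- `T < X ≤ P`: LEMMA A
      have hAX := hA D χ hDA hq hp hAA j hj d r hd hr hdrPT X hXT.le hXP
      have hlogXP : Real.log X ≤ 𝓛 ^ 9 := by
        rw [← hlogP]; exact Real.log_le_log hX0 hXP
      have hβL : ∀ i : ℕ, ‖betaJ c' D i‖ * Real.log X ≤ b₀ := fun i =>
        le_trans (mul_le_mul_of_nonneg_left hlogXP (norm_nonneg _)) (hβ9 i)
      have hmain := norm_logMean_main_le c' χ j d r hlogX0 hb₀0 (hβL (j + 1)) (hβL (j + 2))
      calc _ ≤ ‖(∑ n ∈ Finset.Ioc 0 ⌊X⌋₊, χ (n : ZMod D) * xiZero c' D j n d r / (n : ℂ) *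
                (Real.log (X / n) : ℂ)) -
              deriv χ.LFunction 1 * PiW χ d r *
                (1 + (betaJ c' D (j + 1) + betaJ c' D (j + 2)) * (Real.log X : ℂ) +
                  betaJ c' D (j + 1) * betaJ c' D (j + 2) * (Real.log X : ℂ) ^ 2 / 2)‖ +
            ‖deriv χ.LFunction 1 * PiW χ d r *
                (1 + (betaJ c' D (j + 1) + betaJ c' D (j + 2)) * (Real.log X : ℂ) +
                  betaJ c' D (j + 1) * betaJ c' D (j + 2) * (Real.log X : ℂ) ^ 2 / 2)‖ :=
            norm_le_norm_sub_add _ _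
        _ ≤ CA * (ell D ^ 6)⁻¹ * R + ‖deriv χ.LFunction 1‖ * ‖PiW χ d r‖ * cb :=
            add_le_add hAX hmain
        _ ≤ |CA| * (𝓛 ^ 6)⁻¹ * R + ‖deriv χ.LFunction 1‖ * R * cb := by
            rw [← h𝓛def]
            gcongr
            exact le_abs_self _
        _ = (‖deriv χ.LFunction 1‖ * cb + |CA| * (𝓛 ^ 6)⁻¹) * R := by ring
        _ ≤ B := by rw [hBdef]; linarith [hBtail0]
  -- the tent decomposition and the sum of the three pieces
  have hdec := frakv2_eq_logMeans (χ := χ) c' j hd hr hP1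
  have h1 := hpiece 0.504 le_rfl
  have h2 := hpiece 0.502 (by norm_num)
  have h3 := hpiece 0.5 (by norm_num)
  have hcoef : ‖(((500 / Real.log (bigP D) : ℝ)) : ℂ)‖ = 500 / 𝓛 ^ 9 := by
    rw [Complex.norm_real, hlogP, Real.norm_of_nonneg (by positivity)]
  have hv : ‖frakv2 c' χ j d r‖ ≤ 500 / 𝓛 ^ 9 * (4 * B) := by
    rw [hdec, norm_mul, hcoef]
    refine mul_le_mul_of_nonneg_left ?_ (by positivity)
    calc _ ≤ ‖(∑ n ∈ Finset.Ioc 0 ⌊bigP D ^ (0.504 : ℝ) / ((d * r : ℕ) : ℝ)⌋₊,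
              χ (n : ZMod D) * xiZero c' D j n d r / (n : ℂ) *
                (Real.log (bigP D ^ (0.504 : ℝ) / ((d * r : ℕ) : ℝ) / n) : ℂ)) -
            2 * (∑ n ∈ Finset.Ioc 0 ⌊bigP D ^ (0.502 : ℝ) / ((d * r : ℕ) : ℝ)⌋₊,
              χ (n : ZMod D) * xiZero c' D j n d r / (n : ℂ) *
                (Real.log (bigP D ^ (0.502 : ℝ) / ((d * r : ℕ) : ℝ) / n) : ℂ))‖ +
            ‖∑ n ∈ Finset.Ioc 0 ⌊bigP D ^ (0.5 : ℝ) / ((d * r : ℕ) : ℝ)⌋₊,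
              χ (n : ZMod D) * xiZero c' D j n d r / (n : ℂ) *
                (Real.log (bigP D ^ (0.5 : ℝ) / ((d * r : ℕ) : ℝ) / n) : ℂ)‖ := norm_add_le _ _
      _ ≤ (B + 2 * B) + B := by
          gcongr
          · calc _ ≤ ‖∑ n ∈ Finset.Ioc 0 ⌊bigP D ^ (0.504 : ℝ) / ((d * r : ℕ) : ℝ)⌋₊,
                    χ (n : ZMod D) * xiZero c' D j n d r / (n : ℂ) *
                      (Real.log (bigP D ^ (0.504 : ℝ) / ((d * r : ℕ) : ℝ) / n) : ℂ)‖ +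
                  ‖2 * (∑ n ∈ Finset.Ioc 0 ⌊bigP D ^ (0.502 : ℝ) / ((d * r : ℕ) : ℝ)⌋₊,
                    χ (n : ZMod D) * xiZero c' D j n d r / (n : ℂ) *
                      (Real.log (bigP D ^ (0.502 : ℝ) / ((d * r : ℕ) : ℝ) / n) : ℂ))‖ :=
                  norm_sub_le _ _
              _ ≤ B + 2 * B := by
                  rw [norm_mul, Complex.norm_ofNat]
                  gcongr
      _ = 4 * B := by ring
  refine hv.trans ?_
  -- bookkeeping: `2000B/𝓛⁹ ≤ 2000K₁·(1+𝓛^{1.1})⁴(𝓛⁹)⁻¹·R`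
  have hBle : B ≤ K₁ * W * R := by
    rw [hBdef, hK₁]
    have e1 : ‖deriv χ.LFunction 1‖ * cb * R ≤ 4 * Real.exp (9 / 2) * cb * W * R := by
      have : ‖deriv χ.LFunction 1‖ * cb ≤ 4 * Real.exp (9 / 2) * cb * W := by
        calc ‖deriv χ.LFunction 1‖ * cb ≤ 4 * Real.exp (9 / 2) * 𝓛 ^ 2 * cb := by gcongr
          _ ≤ 4 * Real.exp (9 / 2) * W * cb := by gcongr
          _ = 4 * Real.exp (9 / 2) * cb * W := by ring
      exact mul_le_mul_of_nonneg_right this hR0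
    have e2 : |CA| * (𝓛 ^ 6)⁻¹ * R ≤ |CA| * W * R := by
      have h6 : (𝓛 ^ 6)⁻¹ ≤ 1 := inv_le_one_of_one_le₀ (one_le_pow₀ h𝓛1)
      have : |CA| * (𝓛 ^ 6)⁻¹ ≤ |CA| * W := by
        calc |CA| * (𝓛 ^ 6)⁻¹ ≤ |CA| * 1 := by gcongr
          _ ≤ |CA| * W := by gcongr
      exact mul_le_mul_of_nonneg_right this hR0
    have e3 : |Cξ| * W ≤ |Cξ| * W * R := le_mul_of_one_le_right (by positivity) hR1
    calc (‖deriv χ.LFunction 1‖ * cb + |CA| * (𝓛 ^ 6)⁻¹) * R + |Cξ| * W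
        = ‖deriv χ.LFunction 1‖ * cb * R + |CA| * (𝓛 ^ 6)⁻¹ * R + |Cξ| * W := by ring
      _ ≤ 4 * Real.exp (9 / 2) * cb * W * R + |CA| * W * R + |Cξ| * W * R :=
          add_le_add (add_le_add e1 e2) e3
      _ = (4 * Real.exp (9 / 2) * cb + |CA| + |Cξ|) * W * R := by ring
  calc 500 / 𝓛 ^ 9 * (4 * B) ≤ 500 / 𝓛 ^ 9 * (4 * (K₁ * W * R)) := by gcongr
    _ = 2000 * K₁ * (W * (𝓛 ^ 9)⁻¹) * R := by rw [div_eq_mul_inv]; ring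
    _ = 2000 * K₁ * ((1 + 𝓛 ^ (1.1 : ℝ)) ^ 4 * (𝓛 ^ 9)⁻¹) * R := by rw [hWdef]

/-- **Integer-exponent corollary**: under `Skeleton.Lemma83Rel c′`, for `D` large, (A), `1 ≤ j ≤ 3`,
`d, r ≥ 1`, `dr < P^{0.504}`: `‖𝔳₂ⱼ(d,r)‖ ≤ C·(𝓛⁴)⁻¹·(∏_{q∣dr}(1−q⁻¹)⁻¹)²`
(`(1 + 𝓛^{1.1})⁴ ≤ 16𝓛⁵` via `𝓛^{1.1} ≤ 𝓛^{5/4}`, so `(1+𝓛^{1.1})⁴(𝓛⁹)⁻¹ ≤ 16(𝓛⁴)⁻¹`).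
[cite: Zhang2022LandauSiegel, §10 Lemma 10.2 (10.11) p. 55] -/
theorem frakv2_le_ell4_of_lemma83Rel {c' : ℝ} (h83 : Lemma83Rel c') :
    ∃ C : ℝ, ForAllLarge fun D _ χ => AssumptionA D χ → ∀ j ∈ ({1, 2, 3} : Finset ℕ), ∀ d r : ℕ,
      1 ≤ d → 1 ≤ r → ((d * r : ℕ) : ℝ) < bigP D ^ (0.504 : ℝ) →
        ‖frakv2 c' χ j d r‖ ≤
          C * (ell D ^ 4)⁻¹ * (∏ q ∈ (d * r).primeFactors, (1 - (q : ℝ)⁻¹)⁻¹) ^ 2 := by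
  obtain ⟨C, D₀, h⟩ := frakv2_le_logFree_of_lemma83Rel h83
  obtain ⟨D₅, hD₅⟩ := exists_nat_le_log₄ 5
  refine ⟨16 * max C 0, max D₀ D₅, fun D _ χ hD hq hp hA j hj d r hd hr hdr => ?_⟩
  have hD₀ : D₀ ≤ D := le_trans (le_max_left _ _) hD
  have hL5 : 5 ≤ ell D := by rw [ell]; exact hD₅ D (le_trans (le_max_right _ _) hD)
  have hL1 : 1 ≤ ell D := by linarith
  have hL0 : 0 < ell D := by linarith
  set R : ℝ := (∏ q ∈ (d * r).primeFactors, (1 - (q : ℝ)⁻¹)⁻¹) ^ 2 with hRdef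
  have hR0 : 0 ≤ R := sq_nonneg _
  have hmain := h D χ hD₀ hq hp hA j hj d r hd hr hdr
  -- `(1 + 𝓛^{1.1})⁴ ≤ 16𝓛⁵`
  have hτ : ell D ^ (1.1 : ℝ) ≤ ell D ^ ((5 : ℝ) / 4) :=
    Real.rpow_le_rpow_of_exponent_le hL1 (by norm_num)
  have h54 : (ell D ^ ((5 : ℝ) / 4)) ^ 4 = ell D ^ 5 := by
    rw [← Real.rpow_natCast, ← Real.rpow_mul hL0.le]
    norm_num
  have hone : 1 ≤ ell D ^ ((5 : ℝ) / 4) := Real.one_le_rpow hL1 (by norm_num)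
  have hW : (1 + ell D ^ (1.1 : ℝ)) ^ 4 ≤ 16 * ell D ^ 5 := by
    calc (1 + ell D ^ (1.1 : ℝ)) ^ 4 ≤ (2 * ell D ^ ((5 : ℝ) / 4)) ^ 4 :=
          pow_le_pow_left₀ (by positivity) (by linarith) 4
      _ = 16 * (ell D ^ ((5 : ℝ) / 4)) ^ 4 := by ring
      _ = 16 * ell D ^ 5 := by rw [h54]
  have hrate : (1 + ell D ^ (1.1 : ℝ)) ^ 4 * (ell D ^ 9)⁻¹ ≤ 16 * (ell D ^ 4)⁻¹ := by
    rw [← div_eq_mul_inv, ← div_eq_mul_inv, div_le_div_iff₀ (by positivity) (by positivity)]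
    calc (1 + ell D ^ (1.1 : ℝ)) ^ 4 * ell D ^ 4 ≤ 16 * ell D ^ 5 * ell D ^ 4 := by gcongr
      _ = 16 * ell D ^ 9 := by ring
  have hC : C ≤ max C 0 := le_max_left _ _
  calc ‖frakv2 c' χ j d r‖ ≤ C * ((1 + ell D ^ (1.1 : ℝ)) ^ 4 * (ell D ^ 9)⁻¹) * R := hmain
    _ ≤ max C 0 * ((1 + ell D ^ (1.1 : ℝ)) ^ 4 * (ell D ^ 9)⁻¹) * R := by gcongr
    _ ≤ max C 0 * (16 * (ell D ^ 4)⁻¹) * R := by gcongr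
    _ = 16 * max C 0 * (ell D ^ 4)⁻¹ * R := by ring

/-- **The `𝓛`-free weak bound for the `𝔳₂ⱼ`-sum, UNCONDITIONALLY** (Lemma 8.3 in relative form is a
theorem of the tree, `Skeleton.lemma83Rel_holds`, from the App. A leaves): for `D` large, (A),
`1 ≤ j ≤ 3`, `d, r ≥ 1`, `dr < P^{0.504}`:
`‖𝔳₂ⱼ(d,r)‖ ≤ C·(1 + 𝓛^{1.1})⁴(𝓛⁹)⁻¹·(∏_{q∣dr}(1−q⁻¹)⁻¹)²`.
[cite: Zhang2022LandauSiegel, §10 Lemma 10.2 (10.11) p. 55] -/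
theorem frakv2_le_logFree (c' : ℝ) :
    ∃ C : ℝ, ForAllLarge fun D _ χ => AssumptionA D χ → ∀ j ∈ ({1, 2, 3} : Finset ℕ), ∀ d r : ℕ,
      1 ≤ d → 1 ≤ r → ((d * r : ℕ) : ℝ) < bigP D ^ (0.504 : ℝ) →
        ‖frakv2 c' χ j d r‖ ≤
          C * ((1 + ell D ^ (1.1 : ℝ)) ^ 4 * (ell D ^ 9)⁻¹) *
            (∏ q ∈ (d * r).primeFactors, (1 - (q : ℝ)⁻¹)⁻¹) ^ 2 :=
  frakv2_le_logFree_of_lemma83Rel (lemma83Rel_holds c')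

/-- **Integer-exponent form, UNCONDITIONALLY**: for `D` large, (A), `1 ≤ j ≤ 3`, `d, r ≥ 1`,
`dr < P^{0.504}`: `‖𝔳₂ⱼ(d,r)‖ ≤ C·(𝓛⁴)⁻¹·(∏_{q∣dr}(1−q⁻¹)⁻¹)²` — a window input for the three range
edges of `Θ₁(𝐚₁₁,𝐚₁₃)` (Z22:§10.u036–u038). [cite: Zhang2022LandauSiegel, §10 Lemma 10.2 (10.11) p. 55] -/
theorem frakv2_le_ell4 (c' : ℝ) :
    ∃ C : ℝ, ForAllLarge fun D _ χ => AssumptionA D χ → ∀ j ∈ ({1, 2, 3} : Finset ℕ), ∀ d r : ℕ,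
      1 ≤ d → 1 ≤ r → ((d * r : ℕ) : ℝ) < bigP D ^ (0.504 : ℝ) →
        ‖frakv2 c' χ j d r‖ ≤
          C * (ell D ^ 4)⁻¹ * (∏ q ∈ (d * r).primeFactors, (1 - (q : ℝ)⁻¹)⁻¹) ^ 2 :=
  frakv2_le_ell4_of_lemma83Rel (lemma83Rel_holds c')

/-- **The `(𝓛⁴)⁻¹` bound on the three edge windows of (10.11), UNCONDITIONALLY** (hypothesis shaped as
clause 4 of `Skeleton.Lemma102 c′`: `dr ∈ (P^{0.5}/T, P^{0.5}] ∪ (P^{0.502}/T, P^{0.502}] ∪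
(P^{0.504}/T, P^{0.504})`; each window lies below `P^{0.504}`): for `D` large, (A), `1 ≤ j ≤ 3`,
`d, r ≥ 1`, `‖𝔳₂ⱼ(d,r)‖ ≤ C·(𝓛⁴)⁻¹·(∏_{q∣dr}(1−q⁻¹)⁻¹)²`. The printed `O(𝓛⁻⁷)` is not claimed
(row G-d60-1). [cite: Zhang2022LandauSiegel, §10 Lemma 10.2 (10.11) p. 55] -/
theorem frakv2_windows_le_ell4 (c' : ℝ) :
    ∃ C : ℝ, ForAllLarge fun D _ χ => AssumptionA D χ → ∀ j ∈ ({1, 2, 3} : Finset ℕ), ∀ d r : ℕ,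
      1 ≤ d → 1 ≤ r →
        ((bigP D ^ (0.5 : ℝ) / bigT D < ((d * r : ℕ) : ℝ) ∧ ((d * r : ℕ) : ℝ) ≤ bigP D ^ (0.5 : ℝ)) ∨
          (bigP D ^ (0.502 : ℝ) / bigT D < ((d * r : ℕ) : ℝ) ∧
            ((d * r : ℕ) : ℝ) ≤ bigP D ^ (0.502 : ℝ)) ∨
          (bigP D ^ (0.504 : ℝ) / bigT D < ((d * r : ℕ) : ℝ) ∧
            ((d * r : ℕ) : ℝ) < bigP D ^ (0.504 : ℝ))) →
        ‖frakv2 c' χ j d r‖ ≤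
          C * (ell D ^ 4)⁻¹ * (∏ q ∈ (d * r).primeFactors, (1 - (q : ℝ)⁻¹)⁻¹) ^ 2 := by
  obtain ⟨C, D₀, h⟩ := frakv2_le_ell4 c'
  obtain ⟨D₅, hD₅⟩ := exists_nat_le_log₄ 5
  refine ⟨C, max D₀ D₅, fun D _ χ hD hq hp hA j hj d r hd hr hwin => ?_⟩
  have hD₀ : D₀ ≤ D := le_trans (le_max_left _ _) hD
  have hL5 : 5 ≤ ell D := by rw [ell]; exact hD₅ D (le_trans (le_max_right _ _) hD)
  have hP1 : 1 < bigP D := by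
    rw [bigP]; exact Real.one_lt_exp_iff.2 (by positivity)
  have hlt : ∀ {a : ℝ}, a < 0.504 → bigP D ^ a < bigP D ^ (0.504 : ℝ) := fun ha =>
    Real.rpow_lt_rpow_of_exponent_lt hP1 ha
  refine h D χ hD₀ hq hp hA j hj d r hd hr ?_
  rcases hwin with ⟨-, h1⟩ | ⟨-, h2⟩ | ⟨-, h3⟩
  · exact lt_of_le_of_lt h1 (hlt (by norm_num))
  · exact lt_of_le_of_lt h2 (hlt (by norm_num))
  · exact h3

end Literature.NumberTheory.LFunctions.Zhang2022.Lemma102
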